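import Mathlib
import Summits.ValiantsHypothesis.ValiantsHypothesis.Theses.FreeSubtorus
import Summits.ValiantsHypothesis.ValiantsHypothesis.Theorems.FreeSubtorusSubtorusCovering
import Summits.ValiantsHypothesis.ValiantsHypothesis.Theorems.ImmanantSliceDeterminantalRigidityReductions
import Literature.Computability.AlgebraicComplexity.ValiantConjectureEquivProofs
import Literature.Computability.AlgebraicComplexity.RazElusiveGeneralProofs
import Literature.Computability.AlgebraicComplexity.DeterminantalComplexity
import Literature.Computability.AlgebraicComplexity.EquivariantDC
import Summits.ValiantsHypothesis.ValiantsHypothesis.Theorems.RigidMinimalRepsExpDcGlue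

/-!
# `ConfusionLadder` — the graded covering family through the PROVED floor `SubtorusCovering`
# (crux dir of stmt-ValiantsHypothesis-16133 `OrbitDimensionBound`, route FreeSubtorus; forward rung G1, sorry-free)

FLOOR (seed g1-ValiantsHypothesis-16134, landed):
`Summit.ValiantsHypothesis.ValiantsHypothesis.Theorems.FreeSubtorusSubtorusCovering.subtorusCovering_proof :
 Theses.FreeSubtorus.SubtorusCovering` — for `n ≥ 3`, a `T_Λ`-equivariant (exact `GL_m × GL_m` lifts) affine
determinantal representation of `per_n` of size `m`, `Λ : Fin r → (Fin n ⊕ Fin n) → ℤ` admissible, has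
`C(n, ⌊n/2⌋) ≤ m · 2^r`.

THE FAMILY.  `CoveringRung ℓ` is the floor with the loss factor `2^r` replaced by an arbitrary LOSS FUNCTION
`ℓ n r Λ : ℕ` of the lattice data; it is monotone in `ℓ` (`CoveringRung.mono`: a bigger loss is a weaker rung) and
`CoveringRung powLoss` (`powLoss n r Λ = 2^r`) is LITERALLY the floor (`coveringRung_powLoss_iff : _ ↔ SubtorusCovering`
is `Iff.rfl`; `coveringRung_powLoss` is the seed theorem).

THE RUNG (one move: the loss).  `ConfusionCovering := CoveringRung confusionLoss`, where
`confusionLoss n r Λ = confusion n r Λ (n / 2)` is the CONFUSION NUMBER of `Λ` at the middle level: the largest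
number of pairs `(S, T)` of `⌊n/2⌋`-sets of rows and columns whose indicator characters `(1_S ; 1_T) ∈ ℤ^{2n}` are
congruent to a fixed one modulo `span_ℚ {Λ_i}` (`Confused`).  Since the indicator characters are hypercube points and
`span_ℚ Λ` has dimension `≤ r`, `confusion n r Λ d ≤ 2^r` (Odlyzko 1988; tree named fact
`odlyzko_ncard_hypercube_inter_translate_le`), so the rung implies the floor modulo Odlyzko's lemma; conversely it is
STRICTLY stronger: for `Λ` in general position (no nonzero vector of `span_ℚ Λ` has all coordinates in `{0, ±1}`) of
ANY rank `≤ 2n - 3` the confusion number is `1` and the rung reads `C(n, ⌊n/2⌋) ≤ m`, where the floor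
(`2^r ≥ 2^{n-2}`, `m ≥ n`) is empty of content.  [cite: LandsbergRessayre2017, Thm. 2.8, §6, Question 2.2]
[cite: Odlyzko1988, p. 127]

ASYMPTOTIC SHADOW / ON-PATH.  The summit `ValiantsHypothesis` (`VP_ℂ ≠ VNP_ℂ`) is asymptotic and symmetry-free, so it
implies no fixed-`n` inequality; what it DOES imply is the shadow `CoveringShadow ℓ` of every rung with `ℓ ≥ 1`: along
any sequence of admissibly cut subtori and equivariant representations `B_n` of `per_n` of sizes `m_n`, the function
`n ↦ m_n · ℓ(n, Λ_n)` is not p-bounded (`coveringShadow_of_summit`, via `dc(per_n) ≤ m_n`, p-bounded `dc` ⇒ `per ∈ VP`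
(`isVPFamily_of_isPBounded_determinantalComplexity`, tree) ⇒ `VP = VNP` (`perFamily_mem_VP_iff_VP_eq_VNP`, tree)).
In particular `confusionShadow_of_summit : ValiantsHypothesis → CoveringShadow confusionLoss`.

HOW THE RUNG ADVANCES THE OPEN CRUX `OrbitDimensionBound` (stmt-16133).  The route's `closes` consumes
`OrbitDimensionBound` (symmetrise an optimal expression to an admissible `T_Λ` with `r ≤ n/2`) only through the floor's
loss `2^r ≤ 2^{n/2}`.  With the rung in hand the symmetrisation target relaxes to `OrbitConfusionBound` below: ANY
admissible `Λ` (any rank) whose middle-level confusion number is `≤ 2^{⌊n/2⌋}` — e.g. homotheties × one generic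
one-parameter subgroup (`r = 2n - 3`, confusion `1`).  `closes_relaxed : OrbitConfusionBound → ConfusionCovering →
ValiantsHypothesis` is proved here by feeding the route's own `closes` (its arithmetic is reused verbatim through the
interface `SubtorusCovering`-shaped bound `C(n,⌊n/2⌋) ≤ dc(per_n) · 2^{⌊n/2⌋}`).
-/

set_option linter.dupNamespace false

namespace Summit.ValiantsHypothesis.ValiantsHypothesis.Cruxes.OrbitDimensionBound.Confusion

open Literature.Computability.AlgebraicComplexity

noncomputable section

/-! ## §1 The confusion number of a lattice of characters -/

/-- The indicator character `(1_S ; 1_T) : Fin n ⊕ Fin n → ℤ` of a pair `p = (S, T)` of a row set and a column set.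
[folklore] -/
def pairVec {n : ℕ} (p : Finset (Fin n) × Finset (Fin n)) : (Fin n ⊕ Fin n) → ℤ :=
  Sum.elim (fun k => if k ∈ p.1 then (1 : ℤ) else 0) (fun l => if l ∈ p.2 then (1 : ℤ) else 0)

/-- `Confused Λ p q`: the indicator characters of the pairs `p` and `q` are congruent modulo the rational span of the
generators `Λ_i` (equivalently: they take the same value at a generic element of the subtorus `T_Λ`). [folklore] -/
def Confused {n r : ℕ} (Λ : Fin r → (Fin n ⊕ Fin n) → ℤ) (p q : Finset (Fin n) × Finset (Fin n)) : Prop :=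
  ∃ c : Fin r → ℚ, ∀ x : Fin n ⊕ Fin n,
    ((pairVec p x : ℤ) : ℚ) - ((pairVec q x : ℤ) : ℚ) = ∑ i, c i * ((Λ i x : ℤ) : ℚ)

open Classical in
/-- `classCount n r Λ d q`: the number of level-`d` pairs `(S, T)` (`|S| = |T| = d`) confused with `q`. -/
def classCount (n r : ℕ) (Λ : Fin r → (Fin n ⊕ Fin n) → ℤ) (d : ℕ)
    (q : Finset (Fin n) × Finset (Fin n)) : ℕ :=
  (Finset.filter (fun p : Finset (Fin n) × Finset (Fin n) => p.1.card = d ∧ p.2.card = d ∧ Confused Λ p q)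
    Finset.univ).card

open Classical in
/-- The **confusion number** `κ_d(Λ)` of the lattice data `Λ` at level `d`: the largest number of level-`d` pairs
`(S, T)` (`|S| = |T| = d`) confused with one fixed level-`d` pair.  `κ_d(Λ) ≤ 2^r` (Odlyzko 1988: a translate of an
`r`-dimensional subspace holds `≤ 2^r` hypercube points); `κ_d(Λ) = 1` for `Λ` in general position.
[cite: Odlyzko1988, p. 127] -/
def confusion (n r : ℕ) (Λ : Fin r → (Fin n ⊕ Fin n) → ℤ) (d : ℕ) : ℕ :=
  (Finset.filter (fun q : Finset (Fin n) × Finset (Fin n) => q.1.card = d ∧ q.2.card = d) Finset.univ).sup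
    (classCount n r Λ d)

/-- Every pair is confused with itself. [folklore] -/
theorem confused_refl {n r : ℕ} (Λ : Fin r → (Fin n ⊕ Fin n) → ℤ) (p : Finset (Fin n) × Finset (Fin n)) :
    Confused Λ p p :=
  ⟨fun _ => 0, fun x => by simp⟩

open Classical in
/-- A level-`d` pair's class count is at most the confusion number. [folklore] -/
theorem classCount_le_confusion {n r d : ℕ} (Λ : Fin r → (Fin n ⊕ Fin n) → ℤ)
    (q : Finset (Fin n) × Finset (Fin n)) (hq1 : q.1.card = d) (hq2 : q.2.card = d) :
    classCount n r Λ d q ≤ confusion n r Λ d := by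
  unfold confusion
  exact Finset.le_sup (f := classCount n r Λ d) (Finset.mem_filter.2 ⟨Finset.mem_univ _, hq1, hq2⟩)

open Classical in
/-- A pair lies in its own class. [folklore] -/
theorem one_le_classCount {n r d : ℕ} (Λ : Fin r → (Fin n ⊕ Fin n) → ℤ)
    (q : Finset (Fin n) × Finset (Fin n)) (hq1 : q.1.card = d) (hq2 : q.2.card = d) :
    1 ≤ classCount n r Λ d q := by
  unfold classCount
  exact Finset.one_le_card.2 ⟨q, Finset.mem_filter.2 ⟨Finset.mem_univ _, hq1, hq2, confused_refl Λ q⟩⟩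

/-- The confusion number at a level `d ≤ n` is at least `1` (the class of any level-`d` pair contains the pair).
[folklore] -/
theorem one_le_confusion {n r d : ℕ} (Λ : Fin r → (Fin n ⊕ Fin n) → ℤ) (hd : d ≤ n) :
    1 ≤ confusion n r Λ d := by
  classical
  obtain ⟨S, hS⟩ : ((Finset.univ : Finset (Fin n)).powersetCard d).Nonempty := by
    rw [Finset.powersetCard_nonempty]; simpa using hd
  have hSc : S.card = d := (Finset.mem_powersetCard.1 hS).2
  exact (one_le_classCount Λ (S, S) hSc hSc).trans (classCount_le_confusion Λ (S, S) hSc hSc)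

/-! ## §2 The graded covering family, the floor, the rung -/

/-- A loss function of the lattice data `(n, r, Λ)`. -/
abbrev Loss : Type := (n r : ℕ) → (Fin r → (Fin n ⊕ Fin n) → ℤ) → ℕ

/-- **The graded family `CoveringRung ℓ`.**  For `n ≥ 3`: every affine determinantal representation `B` of `per_n`
of size `m` that is `T_Λ`-equivariant with exact lifts, `Λ` admissible with `r` generators, satisfies
`C(n, ⌊n/2⌋) ≤ m · ℓ(n, r, Λ)`.  The body is the floor `Theses.FreeSubtorus.SubtorusCovering` VERBATIM with `2 ^ r`
replaced by `ℓ n r Λ`. [cite: LandsbergRessayre2017, Thm. 2.8, §6] -/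
def CoveringRung (ℓ : Loss) : Prop :=
  ∀ n : ℕ, 3 ≤ n → ∀ (m r : ℕ) (Λ : Fin r → (Fin n ⊕ Fin n) → ℤ)
    (B : Matrix (Fin m) (Fin m) (MvPolynomial (Fin n × Fin n) ℂ)),
    (∀ i, (∑ k, Λ i (Sum.inl k)) = 0 ∧ (∑ l, Λ i (Sum.inr l)) = 0) →
    Literature.Computability.AlgebraicComplexity.IsEquivariantDetRepr
      (Subgroup.closure {γ : Matrix.GeneralLinearGroup (Fin n × Fin n) ℂ |
        ∃ d e : Fin n → ℂˣ, (∀ i, (∏ k, (d k) ^ (Λ i (Sum.inl k))) * (∏ l, (e l) ^ (Λ i (Sum.inr l))) = 1) ∧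
          (γ : Matrix (Fin n × Fin n) (Fin n × Fin n) ℂ) = Matrix.diagonal (fun p => (d p.1 : ℂ) * (e p.2 : ℂ))})
      (Literature.Computability.AlgebraicComplexity.perPoly (Fin n) ℂ) B →
    Nat.choose n (n / 2) ≤ m * ℓ n r Λ

/-- The floor's loss `2^r`. -/
def powLoss : Loss := fun _ r _ => 2 ^ r

/-- The rung's loss: the confusion number at the middle level `⌊n/2⌋`. -/
def confusionLoss : Loss := fun n r Λ => confusion n r Λ (n / 2)

/-- **THE RUNG `ConfusionCovering`** (one move up from the floor: loss `2^r` ↦ confusion number `κ_{⌊n/2⌋}(Λ)`).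
For `n ≥ 3`, a `T_Λ`-equivariant affine determinantal representation of `per_n` of size `m` (`Λ` admissible, `r`
generators) has `C(n, ⌊n/2⌋) ≤ m · κ_{⌊n/2⌋}(Λ)`. [cite: LandsbergRessayre2017, §6] [cite: Odlyzko1988, p. 127] -/
def ConfusionCovering : Prop := CoveringRung confusionLoss

/-- Dial monotonicity (harder-to-easier): a pointwise bigger loss gives a weaker rung. [folklore] -/
theorem CoveringRung.mono {ℓ ℓ' : Loss} (hle : ∀ n r Λ, ℓ n r Λ ≤ ℓ' n r Λ) (h : CoveringRung ℓ) :
    CoveringRung ℓ' :=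
  fun n hn m r Λ B hΛ hB => (h n hn m r Λ B hΛ hB).trans (Nat.mul_le_mul_left m (hle n r Λ))

/-- The member `ℓ = 2^r` of the family IS the floor statement, literally. [folklore] -/
theorem coveringRung_powLoss_iff :
    CoveringRung powLoss ↔ Summit.ValiantsHypothesis.ValiantsHypothesis.Theses.FreeSubtorus.SubtorusCovering :=
  Iff.rfl

/-- **The floor is proved** (seed g1-ValiantsHypothesis-16134, `subtorusCovering_proof`).
[cite: LandsbergRessayre2017, Thm. 2.8] -/
theorem coveringRung_powLoss : CoveringRung powLoss :=
  Summit.ValiantsHypothesis.ValiantsHypothesis.Theorems.FreeSubtorusSubtorusCovering.subtorusCovering_proof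

/-! ## §3 The asymptotic shadow and the on-path lemma `S → shadow` -/

/-- **Asymptotic shadow of `CoveringRung ℓ`.**  Along ANY sequence `(Λ_n, B_n)` of admissible lattice data and
`T_{Λ_n}`-equivariant affine determinantal representations `B_n` of `per_n` of sizes `m_n` (`n ≥ 3`), the function
`n ↦ m_n · ℓ(n, r_n, Λ_n)` is not p-bounded. [cite: LandsbergRessayre2017, Question 2.2] -/
def CoveringShadow (ℓ : Loss) : Prop :=
  ∀ (m r : ℕ → ℕ) (Λ : (n : ℕ) → Fin (r n) → (Fin n ⊕ Fin n) → ℤ)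
    (B : (n : ℕ) → Matrix (Fin (m n)) (Fin (m n)) (MvPolynomial (Fin n × Fin n) ℂ)),
    (∀ n : ℕ, 3 ≤ n →
      (∀ i, (∑ k, Λ n i (Sum.inl k)) = 0 ∧ (∑ l, Λ n i (Sum.inr l)) = 0) ∧
      Literature.Computability.AlgebraicComplexity.IsEquivariantDetRepr
        (Subgroup.closure {γ : Matrix.GeneralLinearGroup (Fin n × Fin n) ℂ |
          ∃ d e : Fin n → ℂˣ, (∀ i, (∏ k, (d k) ^ (Λ n i (Sum.inl k))) * (∏ l, (e l) ^ (Λ n i (Sum.inr l))) = 1) ∧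
            (γ : Matrix (Fin n × Fin n) (Fin n × Fin n) ℂ) = Matrix.diagonal (fun p => (d p.1 : ℂ) * (e p.2 : ℂ))})
        (Literature.Computability.AlgebraicComplexity.perPoly (Fin n) ℂ) (B n)) →
    ¬ Literature.Computability.AlgebraicComplexity.IsPBounded (fun n => m n * ℓ n (r n) (Λ n))

/-- A numeric rung implies its shadow as soon as the middle binomial coefficient is not p-bounded — recorded as an
implication with that growth fact as a hypothesis (it is elementary: `2^n ≤ (n+1)·C(n,⌊n/2⌋)`). [folklore] -/
theorem coveringShadow_of_coveringRung {ℓ : Loss}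
    (hbin : ¬ Literature.Computability.AlgebraicComplexity.IsPBounded (fun n => Nat.choose n (n / 2)))
    (h : CoveringRung ℓ) : CoveringShadow ℓ := by
  intro m r Λ B hyp hPB
  exact hbin (IsPBounded.of_eventually_le 3 hPB fun n hn => h n hn (m n) (r n) (Λ n) (B n) (hyp n hn).1 (hyp n hn).2)

/-- **ON-PATH LEMMA `S → shadow`.**  `VP_ℂ ≠ VNP_ℂ` implies the shadow of every rung whose loss is `≥ 1`:
`dc(per_n) ≤ m_n ≤ m_n · ℓ` for `n ≥ 3`; a p-bounded `dc(per)` makes `per` a `VP` family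
(`isVPFamily_of_isPBounded_determinantalComplexity`: Berkowitz + substitution), hence `PER ∈ VP`, hence `VP = VNP`
(`perFamily_mem_VP_iff_VP_eq_VNP`, VNP-completeness of `PER`, char `ℂ ≠ 2`). [cite: Burgisser2000, Thm. 2.10, §2.5]
[cite: Valiant1979] -/
theorem coveringShadow_of_summit {ℓ : Loss} (hℓ : ∀ n r Λ, 3 ≤ n → 1 ≤ ℓ n r Λ)
    (hS : _root_.ValiantsHypothesis) : CoveringShadow ℓ := by
  intro m r Λ B hyp hPB
  -- dc(per_n) is p-bounded
  have hdc : IsPBounded (fun n => determinantalComplexity (perPoly (Fin n) ℂ)) := by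
    refine IsPBounded.of_eventually_le 3 hPB fun n hn => ?_
    have hrep : HasDetRepr (perPoly (Fin n) ℂ) (m n) := ⟨B n, (hyp n hn).2.1⟩
    calc determinantalComplexity (perPoly (Fin n) ℂ) ≤ m n := determinantalComplexity_le_of_hasDetRepr hrep
      _ = m n * 1 := (mul_one _).symm
      _ ≤ m n * ℓ n (r n) (Λ n) := Nat.mul_le_mul_left _ (hℓ n (r n) (Λ n) hn)
  -- hence per is a VP family
  have hι : IsPBounded (fun n => Fintype.card (Fin n × Fin n)) :=
    (IsPBounded.mul_holds IsPBounded.id IsPBounded.id).mono fun n => by simp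
  have hVP : IsVPFamily (fun n => perPoly (Fin n) ℂ) :=
    Summit.ValiantsHypothesis.Theorems.DeterminantalRigidityReductions.isVPFamily_of_isPBounded_determinantalComplexity
      hι hdc
  have hmem : perFamily ℂ ∈ VP ℂ := (mem_VP_ofFintype_iff_holds (fun n => perPoly (Fin n) ℂ)).2 hVP
  have hEq : VP ℂ = VNP ℂ := (perFamily_mem_VP_iff_VP_eq_VNP ℂ ringChar_complex_ne_two).1 hmem
  exact hS hEq

/-- The rung's loss is `≥ 1` (`⌊n/2⌋ ≤ n`). [folklore] -/
theorem one_le_confusionLoss (n r : ℕ) (Λ : Fin r → (Fin n ⊕ Fin n) → ℤ) : 1 ≤ confusionLoss n r Λ :=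
  one_le_confusion Λ (Nat.div_le_self n 2)

/-- **`S → shadow of the rung`**: `ValiantsHypothesis → CoveringShadow confusionLoss`. [folklore] -/
theorem confusionShadow_of_summit (hS : _root_.ValiantsHypothesis) : CoveringShadow confusionLoss :=
  coveringShadow_of_summit (fun n r Λ _ => one_le_confusionLoss n r Λ) hS

/-- `S → shadow of the floor`, for the record (`2^r ≥ 1`). [folklore] -/
theorem powShadow_of_summit (hS : _root_.ValiantsHypothesis) : CoveringShadow powLoss :=
  coveringShadow_of_summit (fun _ _ _ _ => Nat.one_le_two_pow) hS

/-! ## §4 How the rung relaxes the open crux `OrbitDimensionBound` -/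

/-- **`OrbitConfusionBound`** — the symmetrisation target RELAXED by the rung: for `n ≥ 3`, every affine
determinantal representation `A` of `per_n` of size `m` can be replaced by one, `B`, of the same size that is
`T_Λ`-equivariant (exact lifts) for SOME admissible `Λ` (any number `r` of generators, any rank) whose middle-level
confusion number is at most `2^{⌊n/2⌋}`.  `OrbitDimensionBound` (admissible `Λ`, `r ≤ n/2`) implies it modulo
Odlyzko's lemma (`κ ≤ 2^r ≤ 2^{⌊n/2⌋}`); general-position `Λ` of rank up to `2n - 3` (a torus of dimension ONE beyond
the homotheties) are now admissible targets. [cite: LandsbergRessayre2017, Question 2.2, §6] -/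
def OrbitConfusionBound : Prop :=
  ∀ n : ℕ, 3 ≤ n → ∀ (m : ℕ) (A : Matrix (Fin m) (Fin m) (MvPolynomial (Fin n × Fin n) ℂ)),
    Literature.Computability.AlgebraicComplexity.IsAffineDetRepr
      (Literature.Computability.AlgebraicComplexity.perPoly (Fin n) ℂ) A →
    ∃ (B : Matrix (Fin m) (Fin m) (MvPolynomial (Fin n × Fin n) ℂ)) (r : ℕ) (Λ : Fin r → (Fin n ⊕ Fin n) → ℤ),
      confusion n r Λ (n / 2) ≤ 2 ^ (n / 2) ∧
      (∀ i, (∑ k, Λ i (Sum.inl k)) = 0 ∧ (∑ l, Λ i (Sum.inr l)) = 0) ∧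
      Literature.Computability.AlgebraicComplexity.IsEquivariantDetRepr
        (Subgroup.closure {γ : Matrix.GeneralLinearGroup (Fin n × Fin n) ℂ |
          ∃ d e : Fin n → ℂˣ, (∀ i, (∏ k, (d k) ^ (Λ i (Sum.inl k))) * (∏ l, (e l) ^ (Λ i (Sum.inr l))) = 1) ∧
            (γ : Matrix (Fin n × Fin n) (Fin n × Fin n) ℂ) = Matrix.diagonal (fun p => (d p.1 : ℂ) * (e p.2 : ℂ))})
        (Literature.Computability.AlgebraicComplexity.perPoly (Fin n) ℂ) B

/-- **Middle-level bound ⇒ VH** (Steps 2–4 of the route's `closes`, isolated as a lemma): if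
`C(n, ⌊n/2⌋) ≤ dc(per_n) · 2^{⌊n/2⌋}` for all `n ≥ 3` then `VP_ℂ ≠ VNP_ℂ`.  Arithmetic `(9/8)^n ≤ dc(per_n)` for
`n ≥ 14` copied from `Theses.FreeSubtorus.closes`; then the tree's `expDcGlue_proof` (exponential `dc` ⇒ VH:
BCS97 Cor. (21.40) qp-boundedness of `dc` on `VP`, `per ∈ VNP`). [cite: Burgisser2000, Thm. 2.10]
[cite: BurgisserClausenShokrollahi1997, Cor. (21.40)] -/
theorem vh_of_middle_bound
    (hstep : ∀ n : ℕ, 3 ≤ n → Nat.choose n (n / 2) ≤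
      Literature.Computability.AlgebraicComplexity.determinantalComplexity
        (Literature.Computability.AlgebraicComplexity.perPoly (Fin n) ℂ) * 2 ^ (n / 2)) :
    _root_.ValiantsHypothesis := by
  -- Arithmetic (a): 162^j (2j+2) ≤ 256^j for j ≥ 7.
  have aux_induct : ∀ j : ℕ, 7 ≤ j → 162 ^ j * (2 * j + 2) ≤ 256 ^ j := by
    intro j hj
    induction j, hj using Nat.le_induction with
    | base => norm_num
    | succ j hj ih =>
      have h1 : 162 * (2 * (j + 1) + 2) ≤ 256 * (2 * j + 2) := by omega
      calc 162 ^ (j + 1) * (2 * (j + 1) + 2) = 162 ^ j * (162 * (2 * (j + 1) + 2)) := by ring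
        _ ≤ 162 ^ j * (256 * (2 * j + 2)) := Nat.mul_le_mul_left _ h1
        _ = 256 * (162 ^ j * (2 * j + 2)) := by ring
        _ ≤ 256 * 256 ^ j := Nat.mul_le_mul_left _ ih
        _ = 256 ^ (j + 1) := by ring
  -- Arithmetic (b): 9^n 2^(n/2) (n+1) ≤ 16^n for n ≥ 14.
  have nine_pow_bound : ∀ n : ℕ, 14 ≤ n → 9 ^ n * 2 ^ (n / 2) * (n + 1) ≤ 16 ^ n := by
    intro n hn
    obtain ⟨j, rfl | rfl⟩ := Nat.even_or_odd' n
    · have hj : 7 ≤ j := by omega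
      have h := aux_induct j hj
      have e1 : (2 * j) / 2 = j := by omega
      rw [e1]
      calc 9 ^ (2 * j) * 2 ^ j * (2 * j + 1) = 162 ^ j * (2 * j + 1) := by
              rw [pow_mul]; rw [← mul_pow]; norm_num
        _ ≤ 162 ^ j * (2 * j + 2) := Nat.mul_le_mul_left _ (by omega)
        _ ≤ 256 ^ j := h
        _ = 16 ^ (2 * j) := by rw [pow_mul]; norm_num
    · have hj : 7 ≤ j := by omega
      have h := aux_induct j hj
      have e1 : (2 * j + 1) / 2 = j := by omega
      rw [e1]
      calc 9 ^ (2 * j + 1) * 2 ^ j * (2 * j + 1 + 1) = 9 * (162 ^ j * (2 * j + 2)) := by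
              rw [pow_succ, pow_mul]; rw [show (9:ℕ) ^ 2 = 81 by norm_num]
              rw [show (81:ℕ) ^ j * 9 * 2 ^ j = 9 * (81 ^ j * 2 ^ j) by ring, ← mul_pow]; norm_num; ring
        _ ≤ 9 * 256 ^ j := Nat.mul_le_mul_left _ h
        _ ≤ 16 * 256 ^ j := Nat.mul_le_mul_right _ (by norm_num)
        _ = 16 ^ (2 * j + 1) := by rw [pow_succ, pow_mul]; norm_num; ring
  -- Arithmetic (c): 2^n ≤ (n+1) C(n, n/2).
  have two_pow_le_choose_middle : ∀ n : ℕ, 2 ^ n ≤ (n + 1) * Nat.choose n (n / 2) := by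
    intro n
    have h := Nat.sum_range_choose n
    rw [← h]
    calc ∑ k ∈ Finset.range (n + 1), Nat.choose n k ≤ ∑ _k ∈ Finset.range (n + 1), Nat.choose n (n / 2) :=
          Finset.sum_le_sum fun k _ => Nat.choose_le_middle k n
      _ = (n + 1) * Nat.choose n (n / 2) := by simp
  -- (9/8)^n ≤ dc(per_n) for n ≥ 14.
  have hexp : ∃ c : ℝ, 1 < c ∧ ∃ n₀ : ℕ, ∀ n ≥ n₀,
      c ^ n ≤ (Literature.Computability.AlgebraicComplexity.determinantalComplexity
        (Literature.Computability.AlgebraicComplexity.perPoly (Fin n) ℂ) : ℝ) := by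
    refine ⟨9 / 8, by norm_num, 14, fun n hn => ?_⟩
    have h14 : (3 : ℕ) ≤ n := le_trans (by norm_num) hn
    have hs := hstep n h14
    have hA := nine_pow_bound n hn
    have hB := two_pow_le_choose_middle n
    set D : ℕ := Literature.Computability.AlgebraicComplexity.determinantalComplexity
      (Literature.Computability.AlgebraicComplexity.perPoly (Fin n) ℂ) with hD
    have hsR : (Nat.choose n (n / 2) : ℝ) ≤ (D : ℝ) * (2 : ℝ) ^ (n / 2) := by exact_mod_cast hs
    have hAR : (9 : ℝ) ^ n * (2 : ℝ) ^ (n / 2) * ((n : ℝ) + 1) ≤ (16 : ℝ) ^ n := by exact_mod_cast hA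
    have hBR : (2 : ℝ) ^ n ≤ ((n : ℝ) + 1) * (Nat.choose n (n / 2) : ℝ) := by exact_mod_cast hB
    have hposn : (0 : ℝ) < (n : ℝ) + 1 := by positivity
    have h8 : (0 : ℝ) < (8 : ℝ) ^ n := by positivity
    have key : (9 / 8 : ℝ) ^ n * ((8 : ℝ) ^ n * (2 : ℝ) ^ (n / 2) * ((n : ℝ) + 1)) ≤
        (D : ℝ) * ((8 : ℝ) ^ n * (2 : ℝ) ^ (n / 2) * ((n : ℝ) + 1)) := by
      have e1 : (9 / 8 : ℝ) ^ n * ((8 : ℝ) ^ n * (2 : ℝ) ^ (n / 2) * ((n : ℝ) + 1)) =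
          (9 : ℝ) ^ n * (2 : ℝ) ^ (n / 2) * ((n : ℝ) + 1) := by
        rw [div_pow]; field_simp
      have e2 : (16 : ℝ) ^ n = (8 : ℝ) ^ n * (2 : ℝ) ^ n := by
        rw [← mul_pow]; norm_num
      rw [e1]
      calc (9 : ℝ) ^ n * (2 : ℝ) ^ (n / 2) * ((n : ℝ) + 1) ≤ (16 : ℝ) ^ n := hAR
        _ = (8 : ℝ) ^ n * (2 : ℝ) ^ n := e2
        _ ≤ (8 : ℝ) ^ n * (((n : ℝ) + 1) * (Nat.choose n (n / 2) : ℝ)) :=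
            mul_le_mul_of_nonneg_left hBR h8.le
        _ ≤ (8 : ℝ) ^ n * (((n : ℝ) + 1) * ((D : ℝ) * (2 : ℝ) ^ (n / 2))) := by
            apply mul_le_mul_of_nonneg_left _ h8.le
            exact mul_le_mul_of_nonneg_left hsR hposn.le
        _ = (D : ℝ) * ((8 : ℝ) ^ n * (2 : ℝ) ^ (n / 2) * ((n : ℝ) + 1)) := by ring
    have hposP : (0 : ℝ) < (8 : ℝ) ^ n * (2 : ℝ) ^ (n / 2) * ((n : ℝ) + 1) := by positivity
    exact le_of_mul_le_mul_right key hposP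
  -- exponential dc ⇒ VH (tree: RigidMinimalReps.ExpDcGlue, proved).
  exact Summit.ValiantsHypothesis.Theorems.expDcGlue_proof hexp

/-- **The relaxed closing: `OrbitConfusionBound → ConfusionCovering → ValiantsHypothesis`.**  For `n ≥ 3` an optimal
expression `A` of `per_n` exists (`hasDetRepr_determinantalComplexity_holds`); `OrbitConfusionBound` re-realises it at
the same size `dc(per_n)` equivariantly under an admissible `T_Λ` of confusion `≤ 2^{⌊n/2⌋}`; the rung gives
`C(n,⌊n/2⌋) ≤ dc(per_n) · κ ≤ dc(per_n) · 2^{⌊n/2⌋}`; `vh_of_middle_bound` concludes.  This is the host route's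
`closes` with BOTH cruxes moved one notch: crux #2 strengthened to the rung (this line's target), crux #1 relaxed.
[cite: LandsbergRessayre2017, Thm. 2.8, Question 2.2] -/
theorem closes_relaxed (h₁ : OrbitConfusionBound) (h₂ : ConfusionCovering) : _root_.ValiantsHypothesis := by
  refine vh_of_middle_bound fun n hn => ?_
  obtain ⟨A, hA⟩ := Literature.Computability.AlgebraicComplexity.hasDetRepr_determinantalComplexity_holds
    (Literature.Computability.AlgebraicComplexity.perPoly (Fin n) ℂ)
  obtain ⟨B, r, Λ, hκ, hΛ, hB⟩ := h₁ n hn _ A hA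
  have h := h₂ n hn _ r Λ B hΛ hB
  calc Nat.choose n (n / 2)
      ≤ Literature.Computability.AlgebraicComplexity.determinantalComplexity
          (Literature.Computability.AlgebraicComplexity.perPoly (Fin n) ℂ) * confusionLoss n r Λ := h
    _ ≤ Literature.Computability.AlgebraicComplexity.determinantalComplexity
          (Literature.Computability.AlgebraicComplexity.perPoly (Fin n) ℂ) * 2 ^ (n / 2) :=
        Nat.mul_le_mul_left _ hκ

/-- For comparison: the host route's own closing from the floor, by name (`OrbitDimensionBound → VH`, since the
floor is proved). [cite: LandsbergRessayre2017, Thm. 2.8] -/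
theorem closes_floor (h₁ : Summit.ValiantsHypothesis.ValiantsHypothesis.Theses.FreeSubtorus.OrbitDimensionBound) :
    _root_.ValiantsHypothesis :=
  Summit.ValiantsHypothesis.ValiantsHypothesis.Theses.FreeSubtorus.closes h₁ coveringRung_powLoss

end

end Summit.ValiantsHypothesis.ValiantsHypothesis.Cruxes.OrbitDimensionBound.Confusion
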